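import Literature.MathematicalPhysics.QuantumFieldTheory.Balaban1983to89.B9Eq3104CommutatorGradFormCurl
import Literature.MathematicalPhysics.QuantumFieldTheory.Balaban1983to89.B9SectBGpTransferOutY

/-!
# NODE 00 — `Node00.OpsYCurlGrad`: (3.4)∘(3.3) AT def-Y's LETTERS — the covariant curl of a covariant gradient is the PLAQUETTE-HOLONOMY DEFECT,
# `(D_U D_U λ)(p_{μν}(x)) = c_f²·(R(U(∂p)) − 1)·W`, `W` the transported far-corner value: all first-order terms cancel (stone 1 of the (3.117) road)

T. Bałaban, *Propagators for lattice gauge theories in a background field*, Commun. Math. Phys. **99** (1985) 389–434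
[`Balaban1985BackgroundPropagators`, "B9"]: (3.3) p. 390 (`D_U` on site functions), (3.4)–(3.5) p. 391 (`D_U` on bond functions, the curl), (3.7) p. 391
(`U(∂p)`), (3.117) p. 419 (*«⟨A − Dλ, Δ(A − Dλ)⟩ = ⟨A, ΔA⟩ − ⟨…, J⟩ … almost invariance of the quadratic form, the error terms are small because the
function J = D*η⁻²Im ∂U is small»*).

statement-level skeleton of published theorems with citation tags; proofs where landed; nothing here is a claim about the Yang–Mills mass gap

WHY THIS FILE (seat node00-def-Y g20; dag-n06-l g15's located L-item «the (3.117) identity on def-Y's carriers `hessGradY = hessY ∘ gradY`», bus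
2026-08-28 l.28037).  def-Y's Hessian of (3.10) is `hessY U = coCurlY U ∘ jordanY U ∘ curlY U + curv2Y U` (`Node00.OpsYDeltaA`), so the Hessian on a pure
gauge mode `hessGradY U = hessY U ∘ gradY U` (`B9PerturbationSplitAtLetters`) BEGINS with `curlY U ∘ gradY U` — the covariant «curl ∘ grad».  Flat, it
vanishes (`OpsYSectDE.curlY_one_comp_gradY_one`, n06-i's `curlK_mul_gradK`); covariantly it does NOT: the transported lifts `trLiftY` of def-Y's letters
do not compose as matrix products, and the defect is exactly the curvature.  THIS FILE proves, at the instance and for EVERY configuration `U`: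
* §1 `gradY_apply_mk` — `(D_Uλ)⟨s, κ⟩ = c_f•(R(U_κ(s))λ̂(s+e_κ) − λ̂(s))`, `λ̂ = λ ∘ chartY` (def-Y FILE 30's `gradY_apply_eq_cdS` in torus coordinates);
  `cdB_gradY_apply` — the bond-sector covariant difference of `D_Uλ`;
* §2 ★★ `curlY_gradY_apply` — **`(D_U D_Uλ)(p_{μν}(x)) = c_f²•(R(U_μ(x)U_ν(x+e_μ))λ̂(x+e_μ+e_ν) − R(U_ν(x)U_μ(x+e_ν))λ̂(x+e_μ+e_ν))`**: the two
  transports of the far-corner value along the two halves of `∂p`; ALL FIRST-ORDER TERMS CANCEL ([B8]'s `B8CurlGradHolonomy.covCurl_covD_covD` ∕ the NE9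
  chain's `B9Eq34CovCurlVector.covCurl_covDeriv`, which live on other carriers — here at def-Y's `curlY ∕ gradY`);
* §3 `holY_mul_path` — `U(∂p)·(U_ν(x)U_μ(x+e_ν)) = U_μ(x)U_ν(x+e_μ)` for def-Y's `holY`; ★★ `curlY_gradY_eq_holY` — **`(D_U D_Uλ)(p) = c_f²•(R(U(∂p))W − W)`**,
  `W = R(U_ν(x)U_μ(x+e_ν))λ̂(x+e_μ+e_ν)` — THE HOLONOMY DEFECT; `curlY_gradY_apply_eq_zero_of_holY` (a flat plaquette kills it) and the operator form
  `curlY_comp_gradY_eq_zero_of_holY` (`U(∂p) = 1` for all `p` ⇒ `curlY U ∘ gradY U = 0`; at `U ↦ 1` this is def-Y's landed `curlY_one_comp_gradY_one`,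
  not restated);
* §4 `norm_curlY_gradY_eq` (§3), `holY_inv`, `norm_holY_le_one`, ★ `norm_curlY_gradY_le` — **`‖(D_U D_Uλ)(p)‖ ≤ c_f²·(‖U(∂p) − 1‖ + ‖U(∂p)⁻¹ − 1‖)·‖λ̂(x+e_μ+e_ν)‖`** under
  unit-bounded transporters (the transport defect `R(P)W − W = (P − 1)WP⁻¹ + W(P⁻¹ − 1)` is first order in `P − 1`: n06's landed
  `B9SectBGpTransferOutY.norm_R_sub_self_le`, imported, not restated): the quantitative face of p.419's «the error terms are small because … Im ∂U is small».
NEXT STONES (not here): `jordanY ∕ coCurlY` of §3's defect and `curv2Y ∘ gradY` recombine into print's current commutator `(i∕2)[J(b), λ(b₋) + R(U_b)λ(b₊)]`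
((3.117) as an operator identity, the NE9 chain's `B9Eq3117HessOpGaugeMode.equiv_hessOp_covDerivL2K` on its carriers; r06's abstract algebra
`B9Eq3117Polarized.two_mul_bondPair_deltaOp_covDη`).
HONEST SCOPE.  Finite algebra in a normed ring over def-Y's landed definitions (`trLiftY` letters through the landed component formula
`B9Eq3104CommutatorGradFormCurl.curlY_apply_eq` (M5.7-est, imported), FILE 30 `OpsYNablaBridge.gradY_apply_eq_cdS ∕ cdS_apply ∕ shiftY_chartY`, b04's
`B5Local114G0Second.shift_shift_comm`, `B9SectBGpTransferOutY.norm_R_sub_self_le` (imported); nothing restated);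
§4's bound is elementary normed-ring algebra, no estimate of [B9] is asserted; count-neutral; N06 NOT discharged; one finite 𝕋^{d+1} programme at fixed ε — nothing continuum, nothing about OS or
the mass gap ∕ Clay.  Cell `pub-ymgap` (HUMAN RULING D-0062), unit `pub-ymgap-node00-def-Y` (g20), 2026-08-28; referee ref-E ∕ ref-H.
-/

noncomputable section

namespace Literature.MathematicalPhysics.QuantumFieldTheory.Balaban1983to89.Node00.OpsYCurlGrad

open Node00
open Node00.OpsYNablaBridge (chartY shiftY_chartY gradY_apply_eq_cdS cdS_apply)
open B9Eq3104CommutatorGradFormCurl (curlY_apply_eq)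
open B6GlobalChartV1 (PV)
open B6KLevelCensusIndexV1 (KIdx)
open B9Eq39Adjoint (R R_one R_sub R_smul)
open B9BackgroundsKLevelV1 (shiftsV1)

variable {𝔸 : Type} [NormedRing 𝔸] [NormedAlgebra ℂ 𝔸] [CompleteSpace 𝔸]
variable {d ℓ : ℕ} {hd : 1 ≤ d + 1} {hL : Odd (ℓ + 1) ∧ 1 < ℓ + 1} {b₀ b₁ : ℝ}
variable (i : KIdx d ℓ hd hL b₀ b₁)

/-! ## §1 `D_Uλ` in torus coordinates -/

/-- **(3.3) in torus coordinates**: `(D_Uλ)⟨s, κ⟩ = c_f•(R(U_κ(s))λ̂(s + e_κ) − λ̂(s))`, `λ̂ = λ ∘ chartY`. [cite: Balaban1985BackgroundPropagators, (3.3) p.390] -/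
theorem gradY_apply_mk (U : CfgY 𝔸 i) (Λ : SiteY i → 𝔸) (s : Site (PV d ℓ i.m i.K hd hL) 0) (κ : Fin (d + 1)) :
    gradY i U Λ ⟨s, κ⟩ = ((i.cf : ℝ) : ℂ) • (R (U κ s) (Λ (chartY i (s.shift κ))) - Λ (chartY i s)) := by
  rw [gradY_apply_eq_cdS, cdS_apply, shiftY_chartY, Equiv.symm_apply_apply]

/-- the bond-sector covariant difference `∇_{U,μ}` (physical units) of `D_Uλ` at `⟨s, κ⟩`:
`c_f•(R(U_μ(s))(D_Uλ)⟨s+e_μ, κ⟩ − (D_Uλ)⟨s, κ⟩)`. [cite: Balaban1985BackgroundPropagators, (3.3)–(3.4) pp.390–391] -/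
theorem cdB_gradY_apply (U : CfgY 𝔸 i) (μ : Fin (d + 1)) (Λ : SiteY i → 𝔸) (s : Site (PV d ℓ i.m i.K hd hL) 0) (κ : Fin (d + 1)) :
    cdB i U μ (gradY i U Λ) ⟨s, κ⟩ = ((i.cf : ℝ) : ℂ) • (R (U μ s) (gradY i U Λ ⟨s.shift μ, κ⟩) - gradY i U Λ ⟨s, κ⟩) := by
  have e1 : (shiftsV1 (PV d ℓ i.m i.K hd hL) μ) s = s.shift μ := rfl
  simp only [cdB, B9Eq39Adjoint.covD, e1]

/-! ## §2 ★★ `D_U ∘ D_U`: all first-order terms cancel -/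

/-- ★★ **(3.4)∘(3.3) — THE COVARIANT CURL OF A COVARIANT GRADIENT**: on `p = p_{μν}(x)`,
`(D_U D_Uλ)(p) = c_f²•(R(U_μ(x)·U_ν(x+e_μ))λ̂(x+e_μ+e_ν) − R(U_ν(x)·U_μ(x+e_ν))λ̂(x+e_μ+e_ν))` — the far-corner value transported back along the two
halves of `∂p`; every first-order term cancels. [cite: Balaban1985BackgroundPropagators, (3.3)–(3.5) pp.390–391, (3.7) p.391, (3.117) p.419] -/
theorem curlY_gradY_apply (U : CfgY 𝔸 i) (Λ : SiteY i → 𝔸) (p : PlaqY i) :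
    curlY i U (gradY i U Λ) p
      = (((i.cf ^ 2 : ℝ)) : ℂ) • (R (U p.μ p.src * U p.ν (p.src.shift p.μ)) (Λ (chartY i ((p.src.shift p.μ).shift p.ν)))
          - R (U p.ν p.src * U p.μ (p.src.shift p.ν)) (Λ (chartY i ((p.src.shift p.μ).shift p.ν)))) := by
  -- the two unit steps of the plaquette commute on the torus
  have hcomm : (p.src.shift p.ν).shift p.μ = (p.src.shift p.μ).shift p.ν :=
    B5Local114G0Second.shift_shift_comm p.src p.ν p.μ
  rw [curlY_apply_eq, cdB_gradY_apply, cdB_gradY_apply, gradY_apply_mk, gradY_apply_mk, gradY_apply_mk, gradY_apply_mk, hcomm,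
    Complex.ofReal_pow, sq, mul_smul]
  simp only [R_smul, R_sub, B9Eq39Adjoint.R_mul, smul_sub]
  abel

/-! ## §3 ★★ The holonomy-defect form -/

/-- **path algebra of `U(∂p)`**: `U(∂p)·(U_ν(x)·U_μ(x+e_ν)) = U_μ(x)·U_ν(x+e_μ)` (def-Y's `holY U p = U_μ(x)U_ν(x+e_μ)U_μ(x+e_ν)⁻¹U_ν(x)⁻¹`).
[cite: Balaban1985BackgroundPropagators, (3.7) p.391, bookkeeping] -/
theorem holY_mul_path (U : CfgY 𝔸 i) (p : PlaqY i) :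
    holY i U p * (U p.ν p.src * U p.μ (p.src.shift p.ν)) = U p.μ p.src * U p.ν (p.src.shift p.μ) := by
  rw [holY]
  group

/-- ★★ **`D_U D_U λ = c_f²·(R(U(∂p)) − 1)·W` — THE HOLONOMY DEFECT**: with `W = R(U_ν(x)U_μ(x+e_ν))λ̂(x+e_μ+e_ν)` (the far-corner value transported
along the `ν`-then-`μ` half of `∂p`), `(D_U D_Uλ)(p) = c_f²•(R(U(∂p))W − W)`; (3.117)'s first mechanism at def-Y's letters.
[cite: Balaban1985BackgroundPropagators, (3.7) p.391, (3.117) p.419] -/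
theorem curlY_gradY_eq_holY (U : CfgY 𝔸 i) (Λ : SiteY i → 𝔸) (p : PlaqY i) :
    curlY i U (gradY i U Λ) p
      = (((i.cf ^ 2 : ℝ)) : ℂ) •
          (R (holY i U p) (R (U p.ν p.src * U p.μ (p.src.shift p.ν)) (Λ (chartY i ((p.src.shift p.μ).shift p.ν))))
            - R (U p.ν p.src * U p.μ (p.src.shift p.ν)) (Λ (chartY i ((p.src.shift p.μ).shift p.ν)))) := by
  rw [curlY_gradY_apply, ← B9Eq39Adjoint.R_mul, holY_mul_path]

/-- a FLAT plaquette kills it: `U(∂p) = 1 ⇒ (D_U D_Uλ)(p) = 0`. [cite: Balaban1985BackgroundPropagators, (3.7) p.391, (3.117) p.419, bookkeeping] -/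
theorem curlY_gradY_apply_eq_zero_of_holY (U : CfgY 𝔸 i) (Λ : SiteY i → 𝔸) {p : PlaqY i} (hp : holY i U p = 1) :
    curlY i U (gradY i U Λ) p = 0 := by
  rw [curlY_gradY_eq_holY, hp, R_one, sub_self, smul_zero]

/-- the operator form on a FLAT configuration: `U(∂p) = 1` for every plaquette ⇒ `curlY U ∘ gradY U = 0` (at `U ↦ 1`: def-Y's `OpsYSectDE.curlY_one_comp_gradY_one`).
[cite: Balaban1985BackgroundPropagators, (3.7) p.391, (3.4) p.391, bookkeeping] -/
theorem curlY_comp_gradY_eq_zero_of_holY (U : CfgY 𝔸 i) (hU : ∀ p : PlaqY i, holY i U p = 1) : curlY i U ∘ₗ gradY i U = 0 := by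
  apply LinearMap.ext
  intro Λ
  funext p
  rw [LinearMap.comp_apply, curlY_gradY_apply_eq_zero_of_holY i U Λ (hU p), LinearMap.zero_apply, Pi.zero_apply]

/-- the size of the defect through the transports: `‖(D_U D_Uλ)(p)‖ ≤ c_f²·‖R(U(∂p))W − W‖` with equality of the vectors — recorded as the `norm` of
§3's identity for the letter files. [cite: Balaban1985BackgroundPropagators, (3.117) p.419 («the error terms are small because the function J … is small»), bookkeeping] -/
theorem norm_curlY_gradY_eq (U : CfgY 𝔸 i) (Λ : SiteY i → 𝔸) (p : PlaqY i) :
    ‖curlY i U (gradY i U Λ) p‖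
      = i.cf ^ 2 * ‖R (holY i U p) (R (U p.ν p.src * U p.μ (p.src.shift p.ν)) (Λ (chartY i ((p.src.shift p.μ).shift p.ν))))
            - R (U p.ν p.src * U p.μ (p.src.shift p.ν)) (Λ (chartY i ((p.src.shift p.μ).shift p.ν)))‖ := by
  rw [curlY_gradY_eq_holY, norm_smul, Complex.norm_real, Real.norm_eq_abs, abs_of_nonneg (sq_nonneg _)]

/-! ## §4 The size of the defect: small when `U(∂p) − 1` is small -/

/-- the inverse holonomy, as a path: `U(∂p)⁻¹ = U_ν(x)·U_μ(x+e_ν)·U_ν(x+e_μ)⁻¹·U_μ(x)⁻¹` (`= U(−∂p)`). [cite: Balaban1985BackgroundPropagators, (3.7) p.391, bookkeeping] -/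
theorem holY_inv (U : CfgY 𝔸 i) (p : PlaqY i) :
    (holY i U p)⁻¹ = U p.ν p.src * U p.μ (p.src.shift p.ν) * (U p.ν (p.src.shift p.μ))⁻¹ * (U p.μ p.src)⁻¹ := by
  rw [holY]
  group

/-- under print's unit-bounded transporters (`‖U_b‖, ‖U_b⁻¹‖ ≤ 1`, the `G₀ ⊂ U(N)` reading): `‖U(∂p)‖ ≤ 1` and `‖U(∂p)⁻¹‖ ≤ 1`.
[cite: Balaban1985BackgroundPropagators, (3.1) p.390, (3.7) p.391, bookkeeping] -/
theorem norm_holY_le_one (U : CfgY 𝔸 i) (hU : ∀ μ x, ‖(U μ x : 𝔸)‖ ≤ 1 ∧ ‖(((U μ x)⁻¹ : 𝔸ˣ) : 𝔸)‖ ≤ 1) (p : PlaqY i) :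
    ‖(holY i U p : 𝔸)‖ ≤ 1 ∧ ‖(((holY i U p)⁻¹ : 𝔸ˣ) : 𝔸)‖ ≤ 1 := by
  have hmul : ∀ a b : 𝔸, ‖a‖ ≤ 1 → ‖b‖ ≤ 1 → ‖a * b‖ ≤ 1 := fun a b ha hb =>
    (norm_mul_le _ _).trans (mul_le_one₀ ha (norm_nonneg _) hb)
  refine ⟨?_, ?_⟩
  · rw [holY, Units.val_mul, Units.val_mul, Units.val_mul]
    exact hmul _ _ (hmul _ _ (hmul _ _ (hU _ _).1 (hU _ _).1) (hU _ _).2) (hU _ _).2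
  · rw [holY_inv, Units.val_mul, Units.val_mul, Units.val_mul]
    exact hmul _ _ (hmul _ _ (hmul _ _ (hU _ _).1 (hU _ _).1) (hU _ _).2) (hU _ _).2

/-- ★ **THE DEFECT IS SMALL WHEN THE PLAQUETTE VARIABLE IS CLOSE TO `1`**: under unit-bounded transporters,
`‖(D_U D_Uλ)(p)‖ ≤ c_f²·(‖U(∂p) − 1‖ + ‖U(∂p)⁻¹ − 1‖)·‖λ̂(x+e_μ+e_ν)‖` — the quantitative face of (3.117)'s «the error terms are small because …
Im ∂U is small». [cite: Balaban1985BackgroundPropagators, (3.117) p.419, (3.7) p.391, (3.1) p.390] -/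
theorem norm_curlY_gradY_le (U : CfgY 𝔸 i) (hU : ∀ μ x, ‖(U μ x : 𝔸)‖ ≤ 1 ∧ ‖(((U μ x)⁻¹ : 𝔸ˣ) : 𝔸)‖ ≤ 1)
    (Λ : SiteY i → 𝔸) (p : PlaqY i) :
    ‖curlY i U (gradY i U Λ) p‖
      ≤ i.cf ^ 2 * ((‖(holY i U p : 𝔸) - 1‖ + ‖(((holY i U p)⁻¹ : 𝔸ˣ) : 𝔸) - 1‖) * ‖Λ (chartY i ((p.src.shift p.μ).shift p.ν))‖) := by
  have hmul : ∀ a b : 𝔸, ‖a‖ ≤ 1 → ‖b‖ ≤ 1 → ‖a * b‖ ≤ 1 := fun a b ha hb =>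
    (norm_mul_le _ _).trans (mul_le_one₀ ha (norm_nonneg _) hb)
  set W := R (U p.ν p.src * U p.μ (p.src.shift p.ν)) (Λ (chartY i ((p.src.shift p.μ).shift p.ν))) with hW
  have hhol := norm_holY_le_one i U hU p
  -- the transported corner value is no larger than the corner value
  have hWle : ‖W‖ ≤ ‖Λ (chartY i ((p.src.shift p.μ).shift p.ν))‖ := by
    rw [hW, R]
    refine (norm_mul_le _ _).trans ((mul_le_mul_of_nonneg_right (norm_mul_le _ _) (norm_nonneg _)).trans ?_)
    rw [Units.val_mul, mul_inv_rev, Units.val_mul]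
    calc ‖(U p.ν p.src : 𝔸) * (U p.μ (p.src.shift p.ν) : 𝔸)‖ * ‖Λ (chartY i ((p.src.shift p.μ).shift p.ν))‖
          * ‖(((U p.μ (p.src.shift p.ν))⁻¹ : 𝔸ˣ) : 𝔸) * (((U p.ν p.src)⁻¹ : 𝔸ˣ) : 𝔸)‖
        ≤ 1 * ‖Λ (chartY i ((p.src.shift p.μ).shift p.ν))‖ * 1 := by
          gcongr
          · exact hmul _ _ (hU _ _).1 (hU _ _).1
          · exact hmul _ _ (hU _ _).2 (hU _ _).2
      _ = ‖Λ (chartY i ((p.src.shift p.μ).shift p.ν))‖ := by ring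
  rw [norm_curlY_gradY_eq]
  refine mul_le_mul_of_nonneg_left ((B9SectBGpTransferOutY.norm_R_sub_self_le _ _).trans ?_) (sq_nonneg _)
  have h1 : ‖(holY i U p : 𝔸) - 1‖ * ‖(((holY i U p)⁻¹ : 𝔸ˣ) : 𝔸)‖ ≤ ‖(holY i U p : 𝔸) - 1‖ :=
    (mul_le_mul_of_nonneg_left hhol.2 (norm_nonneg _)).trans_eq (mul_one _)
  exact mul_le_mul (add_le_add h1 le_rfl) hWle (norm_nonneg _) (by positivity)

end Literature.MathematicalPhysics.QuantumFieldTheory.Balaban1983to89.Node00.OpsYCurlGrad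

end
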